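import Summits.PneNP.PneNP.Theses.Circuit2
import Literature.Computability.MetaComplexity.MCSPProofs

/-!
# Route PneNP/Circuit — support item `CircuitMcspGlue` (stmt-PneNP-1035)

Glue from crux #2 (`CircuitMcspNotPpoly`: MCSP ∉ P/poly) to the route thesis X = ¬(NP ⊆ P/poly):
since `MCSP ∈ NP` (Kabanets–Cai 2000, §2; discharged in-tree as
`Literature.Computability.MetaComplexity.MCSP_mem_NP_holds`, `MCSPProofs.lean`), an inclusion
`NP ⊆ P/poly` would put MCSP in P/poly, contradicting the hypothesis.

Axioms: `propext`, `Classical.choice`, `Quot.sound` (inherited from `MCSP_mem_NP_holds`).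
-/

set_option linter.dupNamespace false -- `Summit.PneNP.PneNP.…`: summit = sub-problem name (D-0017 single-conjunct layout)

namespace Summit.PneNP.PneNP.Theorems

/-- **Item stmt-PneNP-1035 (`CircuitMcspGlue`), proved.** If the Minimum Circuit Size Problem has no
polynomial-size circuit family, then `NP ⊄ P/poly`: `MCSP ∈ NP`
(`Literature.Computability.MetaComplexity.MCSP_mem_NP_holds`, Kabanets–Cai 2000 §2), so `NP ⊆ P/poly`
would give `MCSP ∈ P/poly`. -/
theorem circuitMcspGlue_proof : Summit.PneNP.PneNP.Theses.Circuit2.CircuitMcspGlue := by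
  unfold Summit.PneNP.PneNP.Theses.Circuit2.CircuitMcspGlue
  intro h hsub
  exact h (hsub Literature.Computability.MetaComplexity.MCSP_mem_NP_holds)

end Summit.PneNP.PneNP.Theorems
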